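import Mathlib
import Literature.MathematicalPhysics.StatisticalMechanics.HaggStacking
import Literature.MathematicalPhysics.StatisticalMechanics.BarlowStackingEnergy

/-!
# Route PricedLinkCensus — the site-energy column (`StackingHinge`, line Sketch)
(stub `stub_siteEnergyColumn` of line Sketch, stmt-AtomisticToContinuum-14993)

Fix a pair potential `V`, a scale `(a, h)` with summable aligned / non-aligned layer interactions
`Φ_A(k) = layerInteraction V a h 0 k`, `Φ_N(k) = layerInteraction V a h 1 k`, and suppose the
registry couplings `J_k = barlowCoupling V a h k = Φ_A(k) − Φ_N(k)` are non-positive and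
non-decreasing from `k = 2` on.  Given the WORD COLUMN at all ranges (hypothesis: for summable such
`J`, the alternating word minimises both the forward and the backward local Hägg energies at every
layer, with deficit `J₃ − J₂` for a misaligned side), the hcp site energy
`barlowSiteEnergy V a h alternatingHagg m'` (independent of the layer `m'`) is a pointwise lower
bound for `barlowSiteEnergy V a h s m` for every Hägg word `s` and layer `m`, with deficit
`½ (J₃ − J₂)` for each of the two sides (`m + 2` above, `m − 2` below) not aligned with layer `m`.

Proof.  The tree's layer decomposition `barlowSiteEnergy_eq`
(`site m = e₀ + ½ (haggLocalEnergy J s m + haggBackwardLocalEnergy J s m)`) for `s` and for the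
alternating word; the alternating local energies do not depend on the layer
(`haggAligned_alternating_iff`); add the four inequalities of the word column.

All `[folklore]`.
-/

namespace Summit.AtomisticToContinuum.Crystallization.Theorems.PricedHcpWindowsSiteEnergyColumn

open Literature.MathematicalPhysics.StatisticalMechanics

/-! ### Layer independence of the hcp energies -/

/-- The forward local energy of the alternating word does not depend on the layer. [folklore] -/
theorem haggLocalEnergy_alternating_indep (J : ℕ → ℝ) (m m' : ℤ) :
    haggLocalEnergy J alternatingHagg m = haggLocalEnergy J alternatingHagg m' := by
  rw [haggLocalEnergy_alternating, haggLocalEnergy_alternating]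

/-- The backward local energy of the alternating word does not depend on the layer. [folklore] -/
theorem haggBackwardLocalEnergy_alternating_indep (J : ℕ → ℝ) (m m' : ℤ) :
    haggBackwardLocalEnergy J alternatingHagg m = haggBackwardLocalEnergy J alternatingHagg m' := by
  unfold haggBackwardLocalEnergy
  refine tsum_congr fun k => ?_
  simp only [haggAligned_alternating_iff]

/-- **The hcp site energy does not depend on the layer** (summable layer interactions).
[folklore] -/
theorem barlowSiteEnergy_alternating_indep (V : ℝ → ℝ) (a h : ℝ)
    (hA : Summable fun k : ℕ => layerInteraction V a h 0 k)
    (hN : Summable fun k : ℕ => layerInteraction V a h 1 k) (m m' : ℤ) :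
    barlowSiteEnergy V a h alternatingHagg m = barlowSiteEnergy V a h alternatingHagg m' := by
  rw [barlowSiteEnergy_eq V a h isHaggSeq_alternating hA hN m,
    barlowSiteEnergy_eq V a h isHaggSeq_alternating hA hN m',
    haggLocalEnergy_alternating_indep (barlowCoupling V a h) m m',
    haggBackwardLocalEnergy_alternating_indep (barlowCoupling V a h) m m']

/-! ### The site-energy column at a fixed layer -/

/-- **Site-energy column at one layer.**  Given the four word-column inequalities at layer `m` for
the couplings `J = barlowCoupling V a h` (forward / backward domination by the alternating word,
with deficits `J 3 − J 2` on the misaligned sides), the hcp site energy at `m` is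
below the site energy of `s` at `m`, with deficit `½ (J 3 − J 2)` per misaligned side. [folklore] -/
theorem siteEnergy_le_of_column (V : ℝ → ℝ) (a h : ℝ) {s : ℤ → ℤ} (hs : IsHaggSeq s)
    (hA : Summable fun k : ℕ => layerInteraction V a h 0 k)
    (hN : Summable fun k : ℕ => layerInteraction V a h 1 k) (m : ℤ)
    (h1 : haggLocalEnergy (barlowCoupling V a h) alternatingHagg m ≤
      haggLocalEnergy (barlowCoupling V a h) s m)
    (h2 : ¬ HaggAligned s m 2 → haggLocalEnergy (barlowCoupling V a h) alternatingHagg m +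
      (barlowCoupling V a h 3 - barlowCoupling V a h 2) ≤ haggLocalEnergy (barlowCoupling V a h) s m)
    (h3 : haggBackwardLocalEnergy (barlowCoupling V a h) alternatingHagg m ≤
      haggBackwardLocalEnergy (barlowCoupling V a h) s m)
    (h4 : ¬ HaggAligned s (m - 2) 2 →
      haggBackwardLocalEnergy (barlowCoupling V a h) alternatingHagg m +
        (barlowCoupling V a h 3 - barlowCoupling V a h 2) ≤
          haggBackwardLocalEnergy (barlowCoupling V a h) s m) :
    barlowSiteEnergy V a h alternatingHagg m ≤ barlowSiteEnergy V a h s m ∧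
      barlowSiteEnergy V a h alternatingHagg m +
          (1 / 2) * (barlowCoupling V a h 3 - barlowCoupling V a h 2) *
            ((if HaggAligned s m 2 then 0 else 1) + (if HaggAligned s (m - 2) 2 then 0 else 1)) ≤
        barlowSiteEnergy V a h s m := by
  rw [barlowSiteEnergy_eq V a h isHaggSeq_alternating hA hN m, barlowSiteEnergy_eq V a h hs hA hN m]
  refine ⟨by linarith, ?_⟩
  by_cases hF : HaggAligned s m 2 <;> by_cases hB : HaggAligned s (m - 2) 2
  · rw [if_pos hF, if_pos hB]
    linarith
  · rw [if_pos hF, if_neg hB]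
    have h4' := h4 hB
    linarith
  · rw [if_neg hF, if_pos hB]
    have h2' := h2 hF
    linarith
  · rw [if_neg hF, if_neg hB]
    have h2' := h2 hF
    have h4' := h4 hB
    linarith

/-! ### The stub -/

/-- **Site-energy column** (stub `stub_siteEnergyColumn` of line Sketch of `StackingHinge`).
Given the word column at all ranges (hypothesis): for a pair potential `V`, a scale `(a, h)` with
summable aligned / non-aligned layer interactions and registry couplings
`J_k = barlowCoupling V a h k` with `J k ≤ 0`, `J k ≤ J (k + 1)` for `k ≥ 2`, the hcp site energy
`barlowSiteEnergy V a h alternatingHagg m'` is `≤ barlowSiteEnergy V a h s m` for every Hägg word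
`s` and layers `m, m'`, with deficit `½ (J 3 − J 2)` for each misaligned side of layer `m`.
Proof: `barlowSiteEnergy_eq` for `s` and for `alternatingHagg`, layer independence of the hcp
site energy, and the four inequalities of the word column for `J = barlowCoupling V a h`
(summable as `Φ_A − Φ_N`). [folklore] -/
theorem stub_siteEnergyColumn : (∀ (J : ℕ → ℝ) (s : ℤ → ℤ) (m : ℤ), Literature.MathematicalPhysics.StatisticalMechanics.IsHaggSeq s → Summable J → (∀ k : ℕ, 2 ≤ k → J k ≤ 0) → (∀ k : ℕ, 2 ≤ k → J k ≤ J (k + 1)) → Literature.MathematicalPhysics.StatisticalMechanics.haggLocalEnergy J Literature.MathematicalPhysics.StatisticalMechanics.alternatingHagg m ≤ Literature.MathematicalPhysics.StatisticalMechanics.haggLocalEnergy J s m ∧ (¬ Literature.MathematicalPhysics.StatisticalMechanics.HaggAligned s m 2 → Literature.MathematicalPhysics.StatisticalMechanics.haggLocalEnergy J Literature.MathematicalPhysics.StatisticalMechanics.alternatingHagg m + (J 3 - J 2) ≤ Literature.MathematicalPhysics.StatisticalMechanics.haggLocalEnergy J s m) ∧ Literature.MathematicalPhysics.StatisticalMechanics.haggBackwardLocalEnergy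 J Literature.MathematicalPhysics.StatisticalMechanics.alternatingHagg m ≤ Literature.MathematicalPhysics.StatisticalMechanics.haggBackwardLocalEnergy J s m ∧ (¬ Literature.MathematicalPhysics.StatisticalMechanics.HaggAligned s (m - 2) 2 → Literature.MathematicalPhysics.StatisticalMechanics.haggBackwardLocalEnergy J Literature.MathematicalPhysics.StatisticalMechanics.alternatingHagg m + (J 3 - J 2) ≤ Literature.MathematicalPhysics.StatisticalMechanics.haggBackwardLocalEnergy J s m)) → ∀ (V : ℝ → ℝ) (a h : ℝ) (s : ℤ → ℤ), Literature.MathematicalPhysics.StatisticalMechanics.IsHaggSeq s → Summable (fun k : ℕ => Literature.MathematicalPhysics.StatisticalMechanics.layerInteraction V a h 0 k) → Summable (fun k : ℕ => Literature.MathematicalPhysics.StatisticalMechanics.layerInteraction V a h 1 k) → (∀ k : ℕ, 2 ≤ k → Literature.MathematicalPhysics.StatisticalMechanics.barlowCoupling V a h k ≤ 0) → (∀ k : ℕ, 2 ≤ k → Literature.MathematicalPhysics.StatisticalMechanics.barlowCoupling V a h k ≤ Literature.MathematicalPhysics.StatisticalMechanics.barlowCoupling V a h (k + 1)) → ∀ m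 m' : ℤ, Literature.MathematicalPhysics.StatisticalMechanics.barlowSiteEnergy V a h Literature.MathematicalPhysics.StatisticalMechanics.alternatingHagg m' ≤ Literature.MathematicalPhysics.StatisticalMechanics.barlowSiteEnergy V a h s m ∧ Literature.MathematicalPhysics.StatisticalMechanics.barlowSiteEnergy V a h Literature.MathematicalPhysics.StatisticalMechanics.alternatingHagg m' + (1 / 2) * (Literature.MathematicalPhysics.StatisticalMechanics.barlowCoupling V a h 3 - Literature.MathematicalPhysics.StatisticalMechanics.barlowCoupling V a h 2) * ((if Literature.MathematicalPhysics.StatisticalMechanics.HaggAligned s m 2 then 0 else 1) + (if Literature.MathematicalPhysics.StatisticalMechanics.HaggAligned s (m - 2) 2 then 0 else 1)) ≤ Literature.MathematicalPhysics.StatisticalMechanics.barlowSiteEnergy V a h s m := by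
  intro hW V a h s hs hA hN hJ0 hJm m m'
  have hJ : Summable fun k : ℕ => barlowCoupling V a h k := hA.sub hN
  obtain ⟨h1, h2, h3, h4⟩ := hW (barlowCoupling V a h) s m hs hJ hJ0 hJm
  rw [barlowSiteEnergy_alternating_indep V a h hA hN m' m]
  exact siteEnergy_le_of_column V a h hs hA hN m h1 h2 h3 h4

end Summit.AtomisticToContinuum.Crystallization.Theorems.PricedHcpWindowsSiteEnergyColumn
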